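import Summits.SmoothPoincare4.SmoothPoincare4.Theses.EntropyRung
import Summits.SmoothPoincare4.SmoothPoincare4.Theorems.EntropyRungSubcylindricalExistenceConformalRealisation
import Literature.Geometry.Riemannian.RoundSphereProofs
import Literature.Geometry.Riemannian.AubinYamabeSphereEuclidean
import HarnessLib

/-!
# Realising the warped round metric `g = W² g_S` on Mathlib's `S⁴`
(stub `helper_sphereWarpedRealisation`, witness helper 7 of line `green-blowup-conformal-entropy`,
crux `EntropyRung.SubcylindricalExistence`, item stmt-SmoothPoincare4-10871)

On Mathlib's unit sphere `S⁴ = Metric.sphere (0 : EuclideanSpace ℝ (Fin 5)) 1` with the round metric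
`g_S = roundMetric` and its stereographic chart `φ = extChartAt (𝓡 4) p` at `p` (chart package:
`φ p = 0`, target `univ`, `{−p}ᶜ ⊆ source`, height `⟪φ⁻¹ y, p⟫ = (4 − ‖y‖²)/(4 + ‖y‖²)` — a
HYPOTHESIS here), and a smooth positive `W` with `L W := R_S W − 6 □_S W ≥ 0`, whose zero set lies in
`{x ≠ −p, 2/(1 + ⟪x,p⟫) ≤ 1 + r²/4}` and on which region `W = 2/(1 + ⟪x,p⟫)`, we realise the
conformal metric `g = W² g_S` (`ConformalRealisation.exists_isRiemannian_conformal_sq`) with its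
Levi-Civita connection (`PseudoRiemannianMetric.hasLeviCivita`) and read off:

* `R_g = W⁻³ (R_S W − 6 □_S W)` (`PseudoRiemannianMetric.scalarCurvature_conformal_sq_four`, Aubin
  1982, Ch. 6, §6.3, eq. (1) at `n = 4`), hence `R_g ≥ 0`;
* `R_g x = 0 ⇒ L W x = 0 ⇒ x ≠ −p` and `2/(1 + ⟪x,p⟫) ≤ 1 + r²/4`; with `y = φ x`, `x = φ⁻¹ y` and
  `2/(1 + ⟪x,p⟫) = (4 + ‖y‖²)/4`, so `‖y‖ ≤ r`: the zero set of `R_g` lies in the chart ball;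
* in the chart, `g_S = (4/(‖y‖² + 4))² δ` (`roundMetric_mfderiv_extChartAt_symm`, Lee 2018, Ch. 3)
  and `W(φ⁻¹ y) = (4 + ‖y‖²)/4` on the ball, so `g = W² g_S = δ` there: `g` is EUCLIDEAN on the
  chart ball.

Everything is proved; no definition, no named fact.

References: T. Aubin, *Nonlinear Analysis on Manifolds* (1982), Ch. 6, §6.3 eq. (1) [Aubin1982];
J. M. Lee, *Introduction to Riemannian Manifolds*, 2nd ed. (2018), Ch. 3 (stereographic coordinates
are conformal) [Lee2018].
-/

noncomputable section

-- the registered namespace `Summit.SmoothPoincare4.SmoothPoincare4.Theorems` repeats a component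
set_option linter.dupNamespace false

open scoped Manifold ContDiff Topology ENNReal NNReal ContinuousMap RealInnerProductSpace
open Set Filter MeasureTheory
open Literature.Geometry.Lorentzian Literature.Geometry.Riemannian

namespace Summit.SmoothPoincare4.SmoothPoincare4.Theorems

-- the registered signature binds the Riemannian witness as `hg`, which the statement does not
-- reference; the unused-variables linter is therefore disabled for this one declaration
set_option linter.unusedVariables false in
/-- **Witness helper 7 — realising `g = W² g_S` on `S⁴`** (registered stub
`helper_sphereWarpedRealisation` of line `green-blowup-conformal-entropy`). Given the stereographic
chart package of `S⁴` at every point and a smooth positive `W` with `R_S W − 6 □_S W ≥ 0`, vanishing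
only where `x ≠ −p` and `2/(1 + ⟪x,p⟫) ≤ 1 + r²/4`, and with `W = 2/(1 + ⟪x,p⟫)` there: the conformal
metric `g = W² g_S` is a smooth Riemannian metric with Levi-Civita connection,
`R_g = W⁻³ (R_S W − 6 □_S W) ≥ 0`, its zero set lies in the chart ball `‖φ x‖ ≤ r` at `p`, the ball
lies in the chart target, `g` is Euclidean in the chart on that ball and `W(φ⁻¹ y) = (4 + ‖y‖²)/4`
there. Assembled from `ConformalRealisation.exists_isRiemannian_conformal_sq`,
`PseudoRiemannianMetric.hasLeviCivita`, `PseudoRiemannianMetric.scalarCurvature_conformal_sq_four`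
and `roundMetric_mfderiv_extChartAt_symm`. [cite: Aubin1982, Ch. 6, §6.3, eq. (1)] -/
theorem helper_sphereWarpedRealisation :
    (∀ (p : Metric.sphere (0 : EuclideanSpace ℝ (Fin 5)) 1), extChartAt (𝓡 4) p p = 0 ∧ (extChartAt
      (𝓡 4) p).target = univ ∧ (∀ x : Metric.sphere (0 : EuclideanSpace ℝ (Fin 5)) 1, x ≠ -p → x ∈
      (extChartAt (𝓡 4) p).source) ∧ ∀ y : EuclideanSpace ℝ (Fin 4), ⟪(((extChartAt (𝓡 4) p).symm y
      : Metric.sphere (0 : EuclideanSpace ℝ (Fin 5)) 1) : EuclideanSpace ℝ (Fin 5)), (p :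
      EuclideanSpace ℝ (Fin 5))⟫ = (4 - ‖y‖ ^ 2) / (4 + ‖y‖ ^ 2)) → ∀ [Fact (Module.finrank ℝ
      (EuclideanSpace ℝ (Fin 5)) = 4 + 1)] (p : Metric.sphere (0 : EuclideanSpace ℝ (Fin 5)) 1)
      [(@roundMetric (EuclideanSpace ℝ (Fin 5)) _ _ 4 _).HasLeviCivita] (r : ℝ), 0 < r → ∀ (W :
      Metric.sphere (0 : EuclideanSpace ℝ (Fin 5)) 1 → ℝ), ContMDiff (𝓡 4) 𝓘(ℝ, ℝ) ∞ W → (∀ x, 0 < W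
      x) → (∀ x : Metric.sphere (0 : EuclideanSpace ℝ (Fin 5)) 1, 0 ≤ (@roundMetric (EuclideanSpace
      ℝ (Fin 5)) _ _ 4 _).scalarCurvature x * W x - 6 * (@roundMetric (EuclideanSpace ℝ (Fin 5)) _ _
      4 _).dalembertian W x) → (∀ x : Metric.sphere (0 : EuclideanSpace ℝ (Fin 5)) 1, (@roundMetric
      (EuclideanSpace ℝ (Fin 5)) _ _ 4 _).scalarCurvature x * W x - 6 * (@roundMetric
      (EuclideanSpace ℝ (Fin 5)) _ _ 4 _).dalembertian W x = 0 → x ≠ -p ∧ (2 / (1 + ⟪(x :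
      EuclideanSpace ℝ (Fin 5)), (p : EuclideanSpace ℝ (Fin 5))⟫)) ≤ 1 + r ^ 2 / 4) → (∀ x :
      Metric.sphere (0 : EuclideanSpace ℝ (Fin 5)) 1, x ≠ -p → (2 / (1 + ⟪(x : EuclideanSpace ℝ (Fin
      5)), (p : EuclideanSpace ℝ (Fin 5))⟫)) ≤ 1 + r ^ 2 / 4 → W x = (2 / (1 + ⟪(x : EuclideanSpace
      ℝ (Fin 5)), (p : EuclideanSpace ℝ (Fin 5))⟫))) → ∃ g : PseudoRiemannianMetric (𝓡 4) ∞
      (EuclideanSpace ℝ (Fin 4)) (TangentSpace (𝓡 4) : Metric.sphere (0 : EuclideanSpace ℝ (Fin 5))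
      1 → Type _), ∃ _ : g.HasLeviCivita, ∃ hg : g.IsRiemannian, (∀ (x : Metric.sphere (0 :
      EuclideanSpace ℝ (Fin 5)) 1) (v w : TangentSpace (𝓡 4) x), g.val x v w = W x ^ 2 *
      (@roundMetric (EuclideanSpace ℝ (Fin 5)) _ _ 4 _).val x v w) ∧ (∀ x : Metric.sphere (0 :
      EuclideanSpace ℝ (Fin 5)) 1, g.scalarCurvature x = (W x ^ 3)⁻¹ * ((@roundMetric
      (EuclideanSpace ℝ (Fin 5)) _ _ 4 _).scalarCurvature x * W x - 6 * (@roundMetric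
      (EuclideanSpace ℝ (Fin 5)) _ _ 4 _).dalembertian W x)) ∧ (∀ x : Metric.sphere (0 :
      EuclideanSpace ℝ (Fin 5)) 1, 0 ≤ g.scalarCurvature x) ∧ (∀ x : Metric.sphere (0 :
      EuclideanSpace ℝ (Fin 5)) 1, g.scalarCurvature x = 0 → x ∈ (extChartAt (𝓡 4) p).source ∧
      extChartAt (𝓡 4) p x ∈ Metric.closedBall (extChartAt (𝓡 4) p p) r) ∧ Metric.closedBall
      (extChartAt (𝓡 4) p p) r ⊆ (extChartAt (𝓡 4) p).target ∧ (∀ y ∈ Metric.closedBall (extChartAt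
      (𝓡 4) p p) r, ∀ X Y : EuclideanSpace ℝ (Fin 4), g.val ((extChartAt (𝓡 4) p).symm y) (mfderiv
      𝓘(ℝ, EuclideanSpace ℝ (Fin 4)) (𝓡 4) (extChartAt (𝓡 4) p).symm y X) (mfderiv 𝓘(ℝ,
      EuclideanSpace ℝ (Fin 4)) (𝓡 4) (extChartAt (𝓡 4) p).symm y Y) = ⟪X, Y⟫) ∧ (∀ y ∈
      Metric.closedBall (extChartAt (𝓡 4) p p) r, W ((extChartAt (𝓡 4) p).symm y) = (4 + ‖y‖ ^ 2) /
      4) := by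
  intro hchart _ p _ r hr W hWs hWpos hLW hLW0 hWeq
  obtain ⟨hp0, htgt, hsrc, hinner⟩ := hchart p
  -- Step 1: the metric `g = W² g_S`, Riemannian, with its Levi-Civita connection
  obtain ⟨g, hg, hval⟩ := ConformalRealisation.exists_isRiemannian_conformal_sq
    (@roundMetric (EuclideanSpace ℝ (Fin 5)) _ _ 4 _) isRiemannian_roundMetric hWs hWpos
  haveI hgLC : g.HasLeviCivita := g.hasLeviCivita
  -- Step 2: `R_g = W⁻³ (R_S W − 6 □_S W) ≥ 0`
  have hE : Module.finrank ℝ (EuclideanSpace ℝ (Fin 4)) = 4 := finrank_euclideanSpace_fin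
  have hR : ∀ x : Metric.sphere (0 : EuclideanSpace ℝ (Fin 5)) 1, g.scalarCurvature x =
      (W x ^ 3)⁻¹ * ((@roundMetric (EuclideanSpace ℝ (Fin 5)) _ _ 4 _).scalarCurvature x * W x -
        6 * (@roundMetric (EuclideanSpace ℝ (Fin 5)) _ _ 4 _).dalembertian W x) :=
    PseudoRiemannianMetric.scalarCurvature_conformal_sq_four hE _ g hWs hWpos hval
  have hR0 : ∀ x : Metric.sphere (0 : EuclideanSpace ℝ (Fin 5)) 1, 0 ≤ g.scalarCurvature x :=
    fun x ↦ by
      rw [hR x]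
      exact mul_nonneg (inv_pos.2 (pow_pos (hWpos x) 3)).le (hLW x)
  -- Step 3: chart algebra — `2/(1 + ⟪φ⁻¹ y, p⟫) = (4 + ‖y‖²)/4`, `φ⁻¹ y ≠ −p`
  have hF : ∀ y : EuclideanSpace ℝ (Fin 4),
      2 / (1 + ⟪(((extChartAt (𝓡 4) p).symm y : Metric.sphere (0 : EuclideanSpace ℝ (Fin 5)) 1) :
        EuclideanSpace ℝ (Fin 5)), (p : EuclideanSpace ℝ (Fin 5))⟫) = (4 + ‖y‖ ^ 2) / 4 := by
    intro y
    rw [hinner y]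
    have h4 : (4 : ℝ) + ‖y‖ ^ 2 ≠ 0 := by positivity
    field_simp
    ring
  have hne : ∀ y : EuclideanSpace ℝ (Fin 4),
      ((extChartAt (𝓡 4) p).symm y : Metric.sphere (0 : EuclideanSpace ℝ (Fin 5)) 1) ≠ -p := by
    intro y h
    have h1 := hinner y
    rw [h, coe_neg_sphere, inner_neg_left, real_inner_self_eq_norm_sq, norm_eq_of_mem_sphere]
      at h1
    have h4 : (0 : ℝ) < 4 + ‖y‖ ^ 2 := by positivity
    rw [eq_div_iff h4.ne'] at h1
    nlinarith [sq_nonneg ‖y‖]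
  have hball : ∀ y : EuclideanSpace ℝ (Fin 4),
      y ∈ Metric.closedBall (extChartAt (𝓡 4) p p) r ↔ ‖y‖ ≤ r := fun y ↦ by
    rw [hp0, mem_closedBall_zero_iff]
  -- Step 4: `W(φ⁻¹ y) = (4 + ‖y‖²)/4` on the ball
  have hWball : ∀ y ∈ Metric.closedBall (extChartAt (𝓡 4) p p) r,
      W ((extChartAt (𝓡 4) p).symm y) = (4 + ‖y‖ ^ 2) / 4 := by
    intro y hy
    rw [hball] at hy
    rw [← hF y]
    refine hWeq _ (hne y) ?_
    rw [hF y]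
    have h2 : ‖y‖ ^ 2 ≤ r ^ 2 := pow_le_pow_left₀ (norm_nonneg y) hy 2
    linarith
  refine ⟨g, hgLC, hg, hval, hR, hR0, fun x hx ↦ ?_, fun y _ ↦ ?_, fun y hy X Y ↦ ?_, hWball⟩
  · -- Step 5: the zero set of `R_g` lies in the chart ball
    rw [hR x] at hx
    rcases mul_eq_zero.1 hx with h0 | h0
    · exact absurd h0 (inv_pos.2 (pow_pos (hWpos x) 3)).ne'
    obtain ⟨hxp, hFle⟩ := hLW0 x h0
    have hxs : x ∈ (extChartAt (𝓡 4) p).source := hsrc x hxp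
    refine ⟨hxs, ?_⟩
    rw [hball]
    have hy := hF (extChartAt (𝓡 4) p x)
    rw [(extChartAt (𝓡 4) p).left_inv hxs] at hy
    rw [hy] at hFle
    have h2 : ‖extChartAt (𝓡 4) p x‖ ^ 2 ≤ r ^ 2 := by linarith
    exact (pow_le_pow_iff_left₀ (norm_nonneg _) hr.le two_ne_zero).1 h2
  · -- Step 6: the ball lies in the chart target (`= univ`)
    rw [htgt]
    exact mem_univ _
  · -- Step 7: `g = W² g_S = ((4 + ‖y‖²)/4)² (4/(‖y‖² + 4))² δ = δ` in the chart on the ball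
    rw [hval, roundMetric_mfderiv_extChartAt_symm, hWball y hy]
    have h4 : ‖y‖ ^ 2 + 4 ≠ 0 := by positivity
    field_simp
    ring

end Summit.SmoothPoincare4.SmoothPoincare4.Theorems

end
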